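import Literature.NumberTheory.LFunctions.Zhang2022.RepairRplusPlus2
import Literature.NumberTheory.LFunctions.Zhang2022.RepairBandSlotMain
import Literature.NumberTheory.LFunctions.Zhang2022.RepairGramBlock
import Literature.NumberTheory.LFunctions.Zhang2022.RepairBlenLambda
import Literature.NumberTheory.LFunctions.Zhang2022.RepairBlenMuNu
import Literature.NumberTheory.LFunctions.Zhang2022.RepairBandEdge
import Literature.NumberTheory.LFunctions.Zhang2022.RepairSmoothBandEdge

/-!
# Zhang (2022) §18-margin repair rung — THE RUNNING ASSEMBLY `R⁺⁺`, continuation file (versions 7, …)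

Trunk T-ANT (NumberTheory/LFunctions). Y. Zhang, *Discrete mean estimates and the Landau–Siegel
zero*, arXiv:2211.02515v1 (2022) [Zhang2022LandauSiegel] — **an unrefereed manuscript under
adjudication. WHAT THIS IS NOT: nothing here asserts or denies its Theorems 1–2 or any analytic lemma;
no claim about Landau–Siegel zeros, about Parity, or about a repaired `Margin232` is made. Every
statement is about the manuscript's METHOD AS ARCHITECTED — classes of designs fed to the SAME main-term
calculus (or to a displayed MODEL main term) — not about zeros of `L`-functions.** Cell `landau-siegel`
(rung F-S3), sub-cell E, seat p1 (generation g2), stub S-E-p1-1 «running assembly» of barrier/ASSIGNMENTS.md.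

Continuation of `RepairRplusPlus` (versions 0–3) and `RepairRplusPlus2` (versions 4–6 + the version-6 addendum
p466924: both intake lists of record `bmultiWord5`, `blenWord` ⊆ `Rplusplus6`); those files reached their line
budget. Same protocol (`Repair.DesignFamily`, `ClassDecided`, append-only versions `Rplusplus<k>`, class OF RECORD =
the last version, named in barrier/BARRIER-STATE.md; each version: `Rplusplus<k>`, `rplusplus<k>_decided` by
`classDecided_append` — nothing re-proved —, `mem_rplusplus<k>_iff`, the prefix lemma, the sub-list recoveries of the
slice files' own partial assemblies, the intake lists as sub-lists, the unbundled verdicts, and the table rows in a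
`/-! ### Version k -/` section).

## Class table — version 7 (rows 22–26; rows 1–14 in `RepairRplusPlus`, 15–21 in `RepairRplusPlus2`)

| # | family (decl) | designs, K in words | V (currency) | displayed inputs (kind) | p-id (file) | non-vacuity / tightness / embeddings |
|---|---|---|---|---|---|---|
| 22 «wall0-main» | `familyWallZeroMain` | `WallZeroDesign (c′, g)` of row 12 UNCHANGED: `g` globally 1-Lipschitz, `‖g‖∞ ≤ 1`, wall value `g(1) = 0` (smooth wall-zero profiles, from the wall to any bounded length) | discrete mean, MAIN scale: for every `0 < w < δ`, every `η`, IF `DiscMeanBandMain c′ w η` then eventually, under (b), for every `⌈P^{1+w}⌉ ≤ N ≤ ⌈P^{1+δ}⌉`, `¬ (η·(discMeanAbs⌈P⌉ + 𝔞𝔓) + P^{−w/8}·(discMeanAbs⌈P^{1+w}⌉ + discWeight) < |discMean N − discMean ⌈P⌉|)` | `Repair.DiscMeanBandMain c′ w η` = E-004 AT THE MAIN SCALE `𝔞𝔓` (kind (c), displayed inside the verdict, never asserted) · `Re ρ = ½` on `Skeleton.idx χ` (b) | p466556 (`RepairBandSlotMain`, ls-barrier-p2 g2) ← p459259, p456962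 | **SUPERSEDES row 12 FOR COVERAGE** (ls-barrier-plan g1 RULING 2026-08-26T20:40:37Z): rows 12–13 (`familyWallZero`/`familyWallZeroTop`, p459259) are KEPT but flagged «TRIVIAL-SCALE CURRENCY: their slot `DiscMeanBandWidthWall0` bounds the band by `C·w·discWeight`, and `discWeight = (8/π)𝓛⁹𝔓 + O(𝓛²𝔓)` (p2 g2 units finding, kernel form p467613 `Skeleton.discWeight_trivialScale`) vs main terms `𝔠·𝔞𝔓`, `𝔞 ≪ 𝓛⁴` ⇒ verdict not probative at fixed `(w, C)`»; C4 `familyWallZeroMain_inClass_triangle` (same class, p459259's witnesses apply by name); CONDITIONAL on E-004 (main-scale reading) |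
| 23 «wall0top-main» | `familyWallZeroTopMain` | `WallZeroTopDesign (d, θ)` of row 13 UNCHANGED: wall-zero profile + declared top `θ` with `g = 0` on `[θ, ∞)` | discrete mean, MAIN scale, FULL polynomial: for every `w > 0`, every `η`, IF `DiscMeanBandMain c′ w η` then eventually, under (b), for every `N ≥ ⌈P^{1+w}⌉`, the same `¬ (… < |discMean N − discMean ⌈P⌉|)` | `Repair.DiscMeanBandMain c′ w η` (c) · `Re ρ = ½` (b) | p466556 | SUPERSEDES row 13 FOR COVERAGE (same ruling); C4 `familyWallZeroTopMain_inClass_triangle`; CONDITIONAL on E-004 (main-scale reading); `rplus_wallZeroMain_decided` is the slice file's own `R⁺ ++ [22, 23]` |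
| 24 «mixed» | `KnifeEdge.familyGramBlockAll` | `KnifeEdge.GramDesign (k, piece, gram)`: `k` CONCRETE pieces `piece : Fin k → MixedPiece` (kinked `H¹` bulk, wall value free / wall band datum / Λ-type piece / interior step `𝟙_[0,z₀)`), each admissible (`MixedPiece.Admissible`: `KinkedProfile` / any / `LambdaPiece.Admissible` / `0 < z₀ < 1`), AND the member's MODEL main-term matrix `gram : Matrix (Fin k) (Fin k) ℂ` as a design COORDINATE (B-multi MIXED members, `k ≥ 3` blocks at once; KILL(B-multi) clause «mixed members included») | MODEL currency: `gram.PosSemidef → ∀ x, ¬ (gramForm gram x < 0)` («member OBJ = x†Gx») | ONE slot, kind (c): the member's model matrix is PSD (B-AH / E-014's prediction for an honest dictionary; discrete-level shadow = theorem `discGram_posSemidef` / `discGram_pieces_posSemidef`); which matrix IS the dictionary = rows E-028/E-030/E-034/E-006 (INERT by price), displayed as `GramDictionary`, never asserted | p467185 (`RepairGramBlock`, ls-Bmulti-typer-1 g2) ← p460485, p458738, p459421, p464018 | criterion `gramCloses_iff_not_posSemidef`; pairwise CS does NOT suffice for `k ≥ 3` (`gramThree`, `not_posSemidef_gramThree`)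 and DOES for `k = 2` (`posSemidef_two_iff`, Sylvester); C2 rows 15 and 21 RE-DERIVED from it (`familyWallBand_decided_of_gram`, `familyLambdaBlockAll_decided_of_gram`); C4 `gramWitness_inClass`, `gramWitness'_inClass`; slot load-bearing `familyGramBlockAll_unslotted_fails`; dichotomy `gramDictionary_dichotomy` (an honest non-PSD dictionary is `¬(A)`-content) |
| 25 «(L-b)∣Λ» | `familyLambdaOverhangAll` | `LambdaOverhangDesign (θ, u, u′, L, v′, c)`: `KinkedProfile u u′`, `u(1) = 0`, ONE Λ-type piece `L` OVERHANGING to `θ` (`L.Overhang θ v′`: order `k ≥ 1`, top `= θ > 1`, profile continuous on `[1,θ]` with `L²` marked derivative, zero below the wall, bounded), amplitude `c` (B-len (L-b) «Λχψ-type coefficients on an overhang piece `[1,θ]`», KILL-draft v2.4 §2; WIDER in `θ`, `k`; the «whole profile `[0,θ]`» parenthesis NOT a member — declared) | MODEL currency (E-070/E-071 beyond the wall): in EVERY world `(K, X)`, `LambdaOverhangDiagNonneg θ K → LambdaOverhangCS θ K X → ¬ (lambdaBlockMainTerm K X u u′ L c < 0)` | as WORLD binders: `KnifeEdge.LambdaOverhangDiagNonneg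 θ K` (E-070, sign `+`; redundant given CS, `lambdaOverhangDiagNonneg_of_cs`) · `KnifeEdge.LambdaOverhangCS θ K X` (E-071 in (B1) form = the word's «GIVEN B-AH (E-014)» clause; its failure = `LambdaOverhangIndefinite` = (c)-door E-085) | p467353 (`RepairBlenLambda`, ls-Blen-typer-1 g2; REF-E PASS-pre 20:27:24Z, entry E-15 reserved) ← p461166, p462691, p464018 | EXACT criterion `eLambdaOverhangCloses_iff_indefinite` (the (c)-door is the only door); C2 at `c = 0` the verdict is `R̄`'s positivity (`familyLambdaOverhangAll_verdict_of_amplitude_zero`), class DISJOINT from row 21 (`not_admissible_of_overhang`); C4 `inClass_lenLamBump`, `inClass_lenLamGstarMV` (the 54 `len-lam-*` rows of record); slots inhabited with equality (`saturatingWorld_overhang_slots`) and load-bearing (`lambdaOverhangCross_slot_loadBearing`); CONDITIONAL «GIVEN B-AH (E-014)» |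
| 26 «(L-b)∣Λ graded» | `familyLambdaGradedAll` | `LambdaGradedDesign (θ, u, u′, L, v′)`: same binders as row 25, amplitude existential inside the closing predicate (GRADED currency of p462691: fixed amplitude, `𝔞`-graded cross) | MODEL, graded: in every graded world `(K, G)`, `LambdaOverhangDiagNonneg θ K → LambdaGradedCS θ K G → ∀ a, ¬ LambdaGradedClosesAtFloor K G a u u′ L` (no floor closes) | `KnifeEdge.LambdaOverhangDiagNonneg θ K` · `Repair.LambdaGradedCS θ K G` (the PSD of the graded block at every `𝔞 > 0`; KILL-draft §6 target shape) | p467353 | slot inhabited `lambdaGradedCS_zero`, load-bearing `lambdaGradedCross_slot_loadBearing` (affine world closes at every positive floor); CONDITIONAL «GIVEN B-AH (E-014)» |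

C1 NOTES carried (append-only in the earlier files): rows 12–13 — «CONDITIONAL on E-004, TRIVIAL-SCALE currency,
superseded for coverage by rows 22–23» (this version); row 14 — NON-COVERING threshold (T-2); the «lengths ≥ P / general
coefficients» class is NOT a row: `Repair.lengthsBeyondP_independent` (p463543) is the INDEPENDENCE theorem of record;
the B-len narrowings n-len-1, n-len-2, n-len-3 and the μψ / νψ clauses of (L-b) are NOT covered by this version (S-E-bt2-1
`RepairBlenMuNu`, pending → version 8).

KILL-word alignment (REF-E C1): the intake lists OF RECORD are `Repair.bmultiWord5` (KILL(B-multi) 18:10:26Z, KILL-CERT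
v2.4 96c2304f42278a63) and `Repair.blenWord` (KILL(B-len) 19:19:33Z, KILL-draft v2.4 b46628540b6b957c) — both sub-lists
of version 7 (`bmultiWord5_sub_rplusplus7`, `blenWord_sub_rplusplus7`, inherited from the version-6 addendum, whose
`rplusplus6_decided_words` is the landed statement `ClassDecided (bmultiWord5 ++ blenWord)`); their
successors `bmultiWord6` (+ row 24) and `blenWord2` (+ rows 22–23 twins, 25–26, the μψ/ν rows) get the same lemma here
when p3 lands them. KILL(B-dh) 19:31:07Z has a separate target (`DH.menuConsistent_holds`, E-18), not a row. This file
records the running UNION, not the words. IMPORT RULE: the assembly imports the slice and intake files, never conversely.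

## References

* Y. Zhang, arXiv:2211.02515v1 (2022), §2 Lemma 2.3, Props. 2.4–2.6, (2.13), (2.16)–(2.20), (2.23)–(2.33)
  [p. 4–11], §7 Prop. 7.1, (7.2) [p. 44], §8 Lemma 8.1, (8.11)–(8.12), §10 (10.5).
  [cite: Zhang2022LandauSiegel, §§2, 7, 8, 10]
* R. Horn, C. Johnson, *Matrix Analysis*, 2nd ed., Def. 4.1.9, Thm 7.2.5. [cite: HornJohnson2013, Thm 7.2.5]
-/

noncomputable section

open scoped ComplexOrder

namespace Literature.NumberTheory.LFunctions.Zhang2022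

namespace Repair

/-! ### Version 7 (2026-08-26): the main-scale wall-zero twins, the mixed Gram family, the Λ-overhang families -/

/-- **`R⁺⁺`, version 7**: version 6 (`RepairRplusPlus2.Rplusplus6`, 21 families) followed by the two wall-zero
families restated at the MAIN scale (`familyWallZeroMain`, `familyWallZeroTopMain`, p466556 — superseding rows 12–13
for coverage), the mixed Gram family (`KnifeEdge.familyGramBlockAll`, p467185) and the two Λ-overhang families of the
B-len word's (L-b)∣Λ clause (`familyLambdaOverhangAll`, `familyLambdaGradedAll`, p467353) — rows 22–26 of the table
above. [cite: Zhang2022LandauSiegel, §2 (2.16)–(2.20), (2.32)–(2.33); §7 (7.2) p.44] -/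
def Rplusplus7 : List DesignFamily :=
  Rplusplus6 ++ [familyWallZeroMain, familyWallZeroTopMain, KnifeEdge.familyGramBlockAll, familyLambdaOverhangAll,
    familyLambdaGradedAll]

/-- **Version 7 is decided**: `rplusplus6_decided` for rows 1–21 and the five landed `…_decided` theorems for rows
22–26; nothing re-proved. [cite: Zhang2022LandauSiegel, §2 Props. 2.4–2.6, (2.16)–(2.20), (2.32)–(2.33); §7 (7.2) p.44] -/
theorem rplusplus7_decided : ClassDecided Rplusplus7 :=
  classDecided_append.2
    ⟨rplusplus6_decided,
      classDecided_cons familyWallZeroMain_decided <| classDecided_cons familyWallZeroTopMain_decided <|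
        classDecided_cons KnifeEdge.familyGramBlockAll_decided <| classDecided_cons familyLambdaOverhangAll_decided <|
          classDecided_cons familyLambdaGradedAll_decided classDecided_nil⟩

/-- The families of version 7, by name (the class is EXACTLY these twenty-six).
[cite: Zhang2022LandauSiegel, §2 (2.32)–(2.33)] -/
theorem mem_rplusplus7_iff (F : DesignFamily) :
    F ∈ Rplusplus7 ↔ F = familyR ∨ F = familyH1 ∨ F = familyTwoPiece ∨ F = familyFarPiece ∨
      F = familyRWide ∨ F = familyRCalc ∨ F = KnifeEdge.familyRoughTwoPiece ∨ F = familyRLengths ∨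
      F = familySmoothLengths ∨ F = familySmoothTop ∨ F = familyTwoPieceJoint ∨ F = familyWallZero ∨
      F = familyWallZeroTop ∨ F = familyInPrintLen ∨ F = KnifeEdge.familyWallBand ∨ F = familyJumpBlockAll ∨
      F = familyDetShift ∨ F = KnifeEdge.familyRoughThreePiece ∨ F = KnifeEdge.familyRoughTwoPieceJoint ∨
      F = familyFarBV ∨ F = familyLambdaBlockAll ∨ F = familyWallZeroMain ∨ F = familyWallZeroTopMain ∨
      F = KnifeEdge.familyGramBlockAll ∨ F = familyLambdaOverhangAll ∨ F = familyLambdaGradedAll := by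
  simp only [Rplusplus7, Rplusplus6, Rplusplus5, Rplusplus4, Rplusplus3, Rplusplus2, Rplusplus1, Rplus,
    List.cons_append, List.nil_append, List.mem_cons, List.not_mem_nil, or_false]

/-- **Version 6 ⊆ version 7** (list prefix: no family dropped — rows 12–13 stay, flagged).
[cite: Zhang2022LandauSiegel, §2 (2.32)–(2.33)] -/
theorem rplusplus6_sub_rplusplus7 : ∀ F ∈ Rplusplus6, F ∈ Rplusplus7 :=
  fun _ hF => List.mem_append.2 (Or.inl hF)

/-- `R⁺ ⊆` version 7. [cite: Zhang2022LandauSiegel, §2 (2.32)–(2.33)] -/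
theorem rplus_sub_rplusplus7 : ∀ F ∈ Rplus, F ∈ Rplusplus7 :=
  fun F hF => rplusplus6_sub_rplusplus7 F (rplus_sub_rplusplus6 F hF)

/-- Version 7 restricted to version 6 (consistency of the bookkeeping). [cite: Zhang2022LandauSiegel, §2 (2.32)–(2.33)] -/
theorem rplusplus7_decided_restrict : ClassDecided Rplusplus6 := rplusplus7_decided.mono rplusplus6_sub_rplusplus7

/-- The slice files' partial assemblies are instances of version 7: `R⁺ ++ [wall0-main, wall0top-main]`
(`rplus_wallZeroMain_decided`), `R⁺ ++ [mixed]` (`KnifeEdge.rplus_gramBlockAll_decided`), `R⁺ ++ [(L-b)∣Λ]`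
(`rplus_lambdaOverhangAll_decided`), `R⁺ ++ [(L-b)∣Λ graded]` (`rplus_lambdaGradedAll_decided`) are sub-lists.
[cite: Zhang2022LandauSiegel, §2 (2.32)–(2.33)] -/
theorem rplusplus7_decided_sublists :
    ClassDecided (Rplus ++ [familyWallZeroMain, familyWallZeroTopMain]) ∧
      ClassDecided (Rplus ++ [KnifeEdge.familyGramBlockAll]) ∧
      ClassDecided (Rplus ++ [familyLambdaOverhangAll]) ∧ ClassDecided (Rplus ++ [familyLambdaGradedAll]) := by
  refine ⟨rplusplus7_decided.mono fun F hF => ?_, rplusplus7_decided.mono fun F hF => ?_,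
    rplusplus7_decided.mono fun F hF => ?_, rplusplus7_decided.mono fun F hF => ?_⟩ <;>
  · simp only [Rplus, List.cons_append, List.nil_append, List.mem_cons, List.not_mem_nil, or_false,
      mem_rplusplus7_iff] at hF ⊢
    tauto

/-- **The KILL(B-multi) intake list v5 is inside version 7** (inherited from the version-6 addendum).
[cite: Zhang2022LandauSiegel, §2 (2.32)–(2.33); §7 (7.2) p.44] -/
theorem bmultiWord5_sub_rplusplus7 : ∀ F ∈ bmultiWord5, F ∈ Rplusplus7 :=
  fun F hF => rplusplus6_sub_rplusplus7 F (bmultiWord5_sub_rplusplus6 F hF)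

/-- **The KILL(B-len) intake list v1 is inside version 7** (inherited from the version-6 addendum).
[cite: Zhang2022LandauSiegel, §2 (2.32)–(2.33); §7 Prop 7.1 (7.2) p.44] -/
theorem blenWord_sub_rplusplus7 : ∀ F ∈ blenWord, F ∈ Rplusplus7 :=
  fun F hF => rplusplus6_sub_rplusplus7 F (blenWord_sub_rplusplus6 F hF)

/-- … hence both intake lists of record together with the five new rows are decided, as one sub-list of version 7
(the bare statement `ClassDecided (bmultiWord5 ++ blenWord)` is the landed `rplusplus6_decided_words`, not restated).
[cite: Zhang2022LandauSiegel, §2 (2.32)–(2.33); §7 Prop 7.1 (7.2) p.44] -/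
theorem rplusplus7_decided_words_rows :
    ClassDecided ((bmultiWord5 ++ blenWord) ++ [familyWallZeroMain, familyWallZeroTopMain,
      KnifeEdge.familyGramBlockAll, familyLambdaOverhangAll, familyLambdaGradedAll]) := by
  refine rplusplus7_decided.mono fun F hF => ?_
  rcases List.mem_append.1 hF with h | h
  · rcases List.mem_append.1 h with h' | h'
    · exact bmultiWord5_sub_rplusplus7 F h'
    · exact blenWord_sub_rplusplus7 F h'
  · exact List.mem_append.2 (Or.inr h)

/-- The mixed Gram family ALSO carries rows 15 and 21 (its `k = 2` specialisations re-derive `familyWallBand_decided`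
and `familyLambdaBlockAll_decided`, p467185 Part 3): recorded as the sub-list `[wall/band, Λ-block, mixed]` of version 7.
[cite: Zhang2022LandauSiegel, §7 Prop 7.1 (7.2) p.44] -/
theorem rplusplus7_decided_gramReadings :
    ClassDecided [KnifeEdge.familyWallBand, familyLambdaBlockAll, KnifeEdge.familyGramBlockAll] := by
  refine rplusplus7_decided.mono fun F hF => ?_
  simp only [List.mem_cons, List.not_mem_nil, or_false, mem_rplusplus7_iff] at hF ⊢
  tauto

/-- **Unbundled reading of rows 22–26** (what version 7 adds, every binder literal): the two main-scale wall-zero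
verdicts (slot `DiscMeanBandMain` displayed inside `VerdictMain`), the mixed Gram verdict with its PSD slot, the
Λ-overhang verdict with its two world slots, and the graded Λ-overhang verdict.
[cite: Zhang2022LandauSiegel, §2 (2.16)–(2.20), (2.32)–(2.33); §7 Prop 7.1 (7.2) p.44] -/
theorem rplusplus7_verdicts :
    (∀ d : WallZeroDesign, d.InClass → d.VerdictMain) ∧
    (∀ d : WallZeroTopDesign, d.InClass → d.VerdictMain) ∧
    (∀ (k : ℕ) (p : Fin k → KnifeEdge.MixedPiece) (G : Matrix (Fin k) (Fin k) ℂ),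
        (∀ i, (p i).Admissible) → G.PosSemidef → ∀ x : Fin k → ℂ, ¬ (KnifeEdge.gramForm G x < 0)) ∧
    (∀ (θ : ℝ) (u u' : ℝ → ℂ) (L : KnifeEdge.LambdaPiece) (v' : ℝ → ℂ) (c : ℂ), KinkedProfile u u' → u 1 = 0 →
        L.Overhang θ v' → ∀ (K : KnifeEdge.LambdaDiag) (X : KnifeEdge.LambdaCross),
          KnifeEdge.LambdaOverhangDiagNonneg θ K → KnifeEdge.LambdaOverhangCS θ K X →
            ¬ (KnifeEdge.lambdaBlockMainTerm K X u u' L c < 0)) ∧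
    (∀ (θ : ℝ) (u u' : ℝ → ℂ) (L : KnifeEdge.LambdaPiece) (v' : ℝ → ℂ), KinkedProfile u u' → u 1 = 0 →
        L.Overhang θ v' → ∀ (K : KnifeEdge.LambdaDiag) (G : ℝ → KnifeEdge.LambdaCross),
          KnifeEdge.LambdaOverhangDiagNonneg θ K → LambdaGradedCS θ K G →
            ∀ a : ℝ, ¬ KnifeEdge.LambdaGradedClosesAtFloor K G a u u' L) :=
  ⟨fun d h => familyWallZeroMain_decided d h,
    fun d h => familyWallZeroTopMain_decided d h,
    fun k p G hp hG x => KnifeEdge.familyGramBlockAll_decided ⟨k, p, G⟩ hp hG x,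
    fun θ u u' L v' c hu hu1 hL K X hK hX =>
      familyLambdaOverhangAll_decided ⟨θ, u, u', L, v', c⟩ ⟨hu, hu1, hL⟩ K X hK hX,
    fun θ u u' L v' hu hu1 hL K G hK hG a =>
      familyLambdaGradedAll_decided ⟨θ, u, u', L, v'⟩ ⟨hu, hu1, hL⟩ K G hK hG a⟩

/-- **Rows 12–13 versus rows 22–23, by term**: the superseding main-scale families have the SAME designs and the SAME
class as the trivial-scale ones (only the verdict's slot scale differs) — the bookkeeping fact behind «12–13 kept,
flagged; 22–23 cover». [cite: Zhang2022LandauSiegel, §2 (2.16)–(2.20)] -/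
theorem wallZeroMain_sameClass :
    familyWallZeroMain.Design = familyWallZero.Design ∧ familyWallZeroTopMain.Design = familyWallZeroTop.Design ∧
      (∀ d : WallZeroDesign, familyWallZeroMain.InClass d ↔ familyWallZero.InClass d) ∧
      (∀ d : WallZeroTopDesign, familyWallZeroTopMain.InClass d ↔ familyWallZeroTop.InClass d) :=
  ⟨rfl, rfl, fun _ => Iff.rfl, fun _ => Iff.rfl⟩

/-! ### Version 8 (2026-08-26): the MIXED dictionary and completed-member rows, the μψ and νψ strata; both words' intake
lists v6 / v2 inside the class of record

| # | family (decl) | designs, K in words | V (currency) | displayed inputs (kind) | p-id (file) | non-vacuity / tightness / embeddings |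
|---|---|---|---|---|---|---|
| 27 «mixed-dict» | `KnifeEdge.familyGramBlockDict` | `KnifeEdge.GramDesign (k, piece, gram)` — the SAME designs and class as row 24 (every piece admissible) | MODEL with the DICTIONARY displayed: `gram.IsHermitian → ∀ Λs c′, GramDictionary c′ (fun i => (piece i).table Λs) gram → Prop22i → Lemma23 c′ → (¬(A) eventually: ∃ D₀, ∀ D ≥ D₀, ∀ real primitive χ, ¬ AssumptionA D χ) ∨ ∀ x, ¬ (gramForm gram x < 0)` | `KnifeEdge.GramDictionary c′ T gram` (kind (c): the member's realised tables have main-term matrix `gram` at the MAIN scale `𝔞𝔓` — rows E-028/E-030/E-034/E-006, INERT by price) · the manuscript's `Skeleton.Prop22i`, `Skeleton.Lemma23 c′` (kind (b), weights `≥ 0`) · the balancing scale `Λs` a binder | p469455 (`RepairGramBlock` Parts 7–10, ls-Bmulti-typer-1 g2; REF-E E-19 PASS 21:20:47Z + addendum «dict») ← p467185 | THE COVERAGE ROW for the word's MIXED clause (REF-E E-19 addendum «dict»: the pieces are load-bearing — their tables enter the slot; row 24 stays the model-currency bookkeeping twin); decided by `familyGramBlockAll_dichotomy` (= `gramDictionary_dichotomy`: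 an honest non-PSD dictionary is `¬(A)`-content, via p458037's negative-main-term endgame); C4 `gramWitness_dict_verdict`; p3's intake `bmultiWord6` lists rows 24 AND 27 (p469194) |
| 28 «mixed-completed» | `KnifeEdge.familyGramBordered` | `KnifeEdge.BorderedDesign (u, u′, k, piece, coupling, block)`: a kinked `H¹` bulk `u` (wall value free) ⊕ `k` concrete admissible pieces, with the model data SPLIT as in p458738's worlds — bulk × piece couplings `c` and the further pieces' model matrix `R`; the bulk entry is NOT data but the theorem-level form `𝔅(u)` (`d.gram = bordered 𝔅(u) c R`) | MODEL: `R.PosSemidef → (𝔅(u)•R − c c†).PosSemidef → ∀ x, ¬ (gramForm d.gram x < 0)` | TWO slots (kind (c)): second blocks jointly PSD (the `k`-block `BandNonneg`) · couplings jointly subordinate `𝔅(u)•R − c c† ⪰ 0` (the `k`-block `CrossSubordinate`); bulk positivity `𝔅 ⪰ 0` is NOT a slot — it is the theorem `mainTermForm_nonneg_of_isH1` ON THE CLASS | p469455 (Part 10) ← p458738 | answers REF-E E-19's C3 flag «class-free verdict» at the model level (here the class IS load-bearing); the two slots ⟺ row 24's Gram slot on the completed member (`familyGramBordered_slots_iff`,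 `posSemidef_bordered_bulk_iff`); C2 `k = 1`: `bordered_wall_eq_wallGram` (row 15's E-10 matrix); C4 `familyGramBordered_inClass_witness`; tightness on the kernel mode `coupling_eq_zero_of_gStar` (`𝔅(g⋆) = 0` forces every coupling to vanish) |
| 29 «(L-b)∣μψ» | `familyMuPsiOverhangAll` | `MuPsiDesign (b, g, g′)`: `1 < b`, `OneSidedProfile b g g′` (p458584's binder verbatim: ONE-SIDED whole profile on `[0,b]` beyond the wall — B-len (L-b) «μψ one-sided whole-profile g on [0, b], b ∈ (1,2)»; WIDER: any `b > 1`) | MODEL / ROBUST-price currency of E-073: in EVERY world `(C, M)`, `0 ≤ C → MuPsiDiagNonneg b M → ¬ (M g g′ + C·oneSidedNormSq b g g′ < 0)` (the member is no robust-margin witness at any price level `C`) | as WORLD binders: `Repair.MuPsiDiagNonneg b M` (E-072 sign «the class diagonal is ≥ 0 on one-sided profiles», derivation S/M: shape typed, functional NOT derived; inhabited by the PROVED candidate `sqfreeDiagMass` — `muPsiDiagNonneg_sqfreeDiagMass` — and by `0`) | p469249 (`RepairBlenMuNu`, ls-Blen-typer-1 g2; author-side PASS 21:21:34Z) ← p458584,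 p465279 | CONDITIONAL-ROBUST «GIVEN the E-072 sign» (B-AH reading); DECIDED outright for the candidate diagonal (`familyMuPsiOverhangAll_verdict_sqfree`); threshold T-μψ-2 `robustMuPsiClosing_iff_robustMargin` (p465279) + `muPsi_null_iff_not_robustMargin`; slot load-bearing `muPsiDiag_slot_loadBearing` (in the world `M = Re 𝔅_b` a member IS a robust-margin witness); C4 `inClass_lenMuZhang` / `inClass_lenMuQuad` / `inClass_lenMuPlateau` (the 18 `len-mu-*` rows); exit x2 (E-032-class / E-073 input) is where an E*-len input would enter |
| 30 «(L-b)∣νψ» | `familyNuOverhangAll` | `NuDesign (θ, v, v′)`: `1 < θ`, `KnifeEdge.bvOverhang θ v v′` (sup-bounded BV profile on `[1,θ]`, zero off it — ls-theory's ruling class; plain `ν = 1∗χ` piece; B-len (L-b) «νψ = (1∗χ)ψ·v(z_n)»; the VARIANTS `ν·log n`, `ν∗(smooth)`, `(1∗χ)(P_j/n)^β` are NOT members — declared) | INVISIBILITY currency: in EVERY world `(c′, S)`, GIVEN the slot and the (b)-binders, the class's dictionary of record at scale `S` is `(M, X) = (0, 0)` (`NuDict … (fun _ _ => 0) 0`)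 AND the member is LEVER-FREE: added to ANY design polynomial family `F` with main constant `m ≥ 0` (`HasMainConstant c′ S F m`) the extended family `d.extend F` has the same main constant `m` | `KnifeEdge.NuMeanInvisible c′ θ (bvOverhang θ) S` (E-074′, derivation S — ls-theory 17:33:45Z; kind (c)) · `ScaleEventuallyPos S`, `Skeleton.Prop22i`, `Skeleton.Lemma23 c′` (kind (b)) | p469249 ← p461177, p468144 | DECIDED-GIVEN-SLOT (`nuDict_zero_of_meanInvisible`, `mainTerm_add_nuPiece`); the Lipschitz sub-class embeds by term (`NuDesign.inClass_of_lipOverhang`, `inClass_lipTent`) — its DECIDED-BY-THEOREM row (`familyNuLipOverhangAll`, ls-Blen-typer-2 g2, S-E-bt2-2, via p468144's E-074′ kernel) joins as row 31 when it lands; C4 `inClass_lenNuPiece` (`lenNuBump`, `lenNuRampcut` — the 48 `len-nu-*` rows; the 12 rampcut jump rows are counted here), `verdict_lenNu` |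
| 31 «band edge» | `familyBandEdge` | `BandEdgeDesign (c′, g)`: `g` globally 1-Lipschitz, `‖g‖∞ ≤ 1` (NO wall/top condition; ⊇ row 4 `inClass_ofFarPiece'`, ⊇ rows 12/22's class `inClass_ofWallZero`) | discrete mean, from the TRUE band edge: ∀ `δ > 0` ∀ `A : ℕ`, eventually under (b), for every `⌈D·P·𝓛^{1058+2A}⌉ + 1 ≤ N₁ ≤ N₂ ≤ ⌈P^{1+δ}⌉`, `¬ ((𝓛^A)⁻¹·(discMeanAbs N₁ + discWeight) < |discMean N₂ − discMean N₁|)` | `Re ρ = ½` (b) ONLY — NO slot | p469716 (`RepairBandEdge`, ls-barrier-p2 g2) ← p469201, p469409 (`tailInvisible_bandScale`, `discMeanFlat_bandEdge`: PV + Abel from the band edge) | UNCONDITIONAL given (b); supersedes the fixed-`ε` thresholds `P^{1+ε}` of rows 4/9/10 FOR COVERAGE (those rows stay): the E-004 seam shrinks to the `(1+o(1))·α̃`-band `[P, D·P·𝓛^c]`; main-order reading `o(𝔞𝔓)` for `A ≥ 10` by p467613 (`discMeanFlat_bandEdge_mainScale`, Prop71/Lemma81/Prop22i/Lemma23 displayed);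 C4 `inClass_const_one`, `inClass_triangle'` |
| 32 «smooth, band edge» | `familySmoothBandEdge` | `SmoothDesign (c′, K, M, g)` = row 9's class EXACTLY (`familySmoothBandEdge_inClass_iff`) | same shape with `max(K,M)²·discWeight`, all pairs `N₁ ≤ N₂ ≤ ⌈P^{1+δ}⌉` from the band edge | (b) only — NO slot | p470027 (`RepairSmoothBandEdge`, p2 g2) | UNCONDITIONAL given (b); C4 = row 9's (`inClass_flat`, `inClass_phiTop`, `inClass_glue`), `familySmoothBandEdge_inClass_flat` |
| 33 «smooth top, band edge» | `familySmoothTopBandEdge` | `SmoothTopDesign` = row 10's class EXACTLY (`familySmoothTopBandEdge_inClass_iff`) | FULL polynomial: every `N₂ ≥ N₁`, `N₁` from the band edge up to `⌈P^{1+δ}⌉`, `δ = |θ−1|+1` | (b) only — NO slot | p470027 | UNCONDITIONAL given (b); `rplus_smoothBandEdge_decided` is the slice file's `R⁺ ++ [32, 33]` |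

C1 NOTES carried: row 24 — REF-E E-19 PASS (RepairGramBlock p467185 + p468343) with the C3 flag «class-free verdict (pieces
not load-bearing); CONDITIONAL given B-AH (E-014); discrete shadow a theorem» — rows 27–28 are the two answers (dictionary
displayed / class load-bearing); rows 25–26 — REF-E E-15 pending; rows 29–30 — author-side PASS (ls-Blen-plan g2 21:21:34Z),
REF-E entries pending; rows 31–33 — E-entry requested by p2 g2 21:48:46Z (kind: extension WITHOUT slot). NOT rows (never listed): the sum families `familyBmulti6` / `familyBlen2` (they are the words) and
the pieces-only / discrete-level presentations `KnifeEdge.familyGramBlock`, `KnifeEdge.familyGramTables` (bookkeeping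
twins inside RepairGramBlock; the latter is a THEOREM at the discrete level for every finite table family, available by
name). UNCOVERED sub-words of the B-len word (u1–u7 of RepairIntakeBlen) and of the B-multi word (u1–u3 of RepairIntakeBmulti)
stand as STATEMENTS ONLY.

KILL-word alignment (REF-E C1): the intake lists OF RECORD are now `Repair.bmultiWord6` (RepairIntakeBmulti Part 11, p469194,
ls-Bmulti-typer-1 g2: `bmultiWord5 ++ [familyGramBlockAll, familyGramBlockDict]`) and `Repair.blenWord2` (RepairIntakeBlen
Part 5, ls-barrier-p1 g2 for p3: `blenWord ++ [familyLambdaOverhangAll, familyLambdaGradedAll, familyMuPsiOverhangAll,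
familyNuOverhangAll, familyWallZeroMain, familyWallZeroTopMain]`) — BOTH are sub-lists of version 8
(`bmultiWord6_sub_rplusplus8`, `blenWord2_sub_rplusplus8`, `rplusplus8_decided_words`): with version 8 EVERY constructor of
both killed classes `K_multi` (v6) and `𝒟_len` (v2) dispatches to a family of the class of record. KILL(B-dh) has its own
target (`DH.menuConsistent_holds`, E-18; p4); KILL(B-fam) (20:55:00Z) has its own decided class `bfamWord` (S-E-bf1-1),
never a row here; KILL(B-det) pending (pre-word draft `RepairIntakeBdet`, S-E-t2-3: its constructors dispatch to rows 17
and 2 already). -/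

/-- **`R⁺⁺`, version 8**: version 7 followed by the mixed DICTIONARY row and the COMPLETED-member row
(`KnifeEdge.familyGramBlockDict`, `KnifeEdge.familyGramBordered`, p469455), the μψ / νψ strata of the B-len word's
(L-b) clause (`familyMuPsiOverhangAll`, `familyNuOverhangAll`, p469249) and the three slot-free BAND-EDGE families
(`familyBandEdge`, p469716; `familySmoothBandEdge`, `familySmoothTopBandEdge`, p470027) — rows 27–33 of the table above.
[cite: Zhang2022LandauSiegel, §2 (2.16)–(2.20), (2.32)–(2.33); §7 Prop 7.1 (7.2) p.44] -/
def Rplusplus8 : List DesignFamily :=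
  Rplusplus7 ++ [KnifeEdge.familyGramBlockDict, KnifeEdge.familyGramBordered, familyMuPsiOverhangAll,
    familyNuOverhangAll, familyBandEdge, familySmoothBandEdge, familySmoothTopBandEdge]

/-- **Version 8 is decided**: `rplusplus7_decided` for rows 1–26 and the seven landed `…_decided` theorems for rows
27–33; nothing re-proved. [cite: Zhang2022LandauSiegel, §2 Props. 2.4–2.6, (2.16)–(2.20), (2.32)–(2.33); §7 (7.2) p.44] -/
theorem rplusplus8_decided : ClassDecided Rplusplus8 :=
  classDecided_append.2
    ⟨rplusplus7_decided,
      classDecided_cons KnifeEdge.familyGramBlockDict_decided <| classDecided_cons KnifeEdge.familyGramBordered_decided <|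
        classDecided_cons familyMuPsiOverhangAll_decided <| classDecided_cons familyNuOverhangAll_decided <|
          classDecided_cons familyBandEdge_decided <| classDecided_cons familySmoothBandEdge_decided <|
            classDecided_cons familySmoothTopBandEdge_decided classDecided_nil⟩

/-- The families of version 8, by name (the class is EXACTLY these thirty-three).
[cite: Zhang2022LandauSiegel, §2 (2.32)–(2.33)] -/
theorem mem_rplusplus8_iff (F : DesignFamily) :
    F ∈ Rplusplus8 ↔ F = familyR ∨ F = familyH1 ∨ F = familyTwoPiece ∨ F = familyFarPiece ∨
      F = familyRWide ∨ F = familyRCalc ∨ F = KnifeEdge.familyRoughTwoPiece ∨ F = familyRLengths ∨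
      F = familySmoothLengths ∨ F = familySmoothTop ∨ F = familyTwoPieceJoint ∨ F = familyWallZero ∨
      F = familyWallZeroTop ∨ F = familyInPrintLen ∨ F = KnifeEdge.familyWallBand ∨ F = familyJumpBlockAll ∨
      F = familyDetShift ∨ F = KnifeEdge.familyRoughThreePiece ∨ F = KnifeEdge.familyRoughTwoPieceJoint ∨
      F = familyFarBV ∨ F = familyLambdaBlockAll ∨ F = familyWallZeroMain ∨ F = familyWallZeroTopMain ∨
      F = KnifeEdge.familyGramBlockAll ∨ F = familyLambdaOverhangAll ∨ F = familyLambdaGradedAll ∨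
      F = KnifeEdge.familyGramBlockDict ∨ F = KnifeEdge.familyGramBordered ∨ F = familyMuPsiOverhangAll ∨
      F = familyNuOverhangAll ∨ F = familyBandEdge ∨ F = familySmoothBandEdge ∨ F = familySmoothTopBandEdge := by
  simp only [Rplusplus8, Rplusplus7, Rplusplus6, Rplusplus5, Rplusplus4, Rplusplus3, Rplusplus2, Rplusplus1, Rplus,
    List.cons_append, List.nil_append, List.mem_cons, List.not_mem_nil, or_false]

/-- **Version 7 ⊆ version 8** (list prefix: no family dropped). [cite: Zhang2022LandauSiegel, §2 (2.32)–(2.33)] -/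
theorem rplusplus7_sub_rplusplus8 : ∀ F ∈ Rplusplus7, F ∈ Rplusplus8 :=
  fun _ hF => List.mem_append.2 (Or.inl hF)

/-- `R⁺ ⊆` version 8. [cite: Zhang2022LandauSiegel, §2 (2.32)–(2.33)] -/
theorem rplus_sub_rplusplus8 : ∀ F ∈ Rplus, F ∈ Rplusplus8 :=
  fun F hF => rplusplus7_sub_rplusplus8 F (rplus_sub_rplusplus7 F hF)

/-- Version 8 restricted to version 7 (consistency of the bookkeeping). [cite: Zhang2022LandauSiegel, §2 (2.32)–(2.33)] -/
theorem rplusplus8_decided_restrict : ClassDecided Rplusplus7 := rplusplus8_decided.mono rplusplus7_sub_rplusplus8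

/-- The slice files' partial assemblies are instances of version 8: `R⁺ ++ [mixed-dict]`
(`KnifeEdge.rplus_gramBlockDict_decided`), `R⁺ ++ [mixed-completed]` (`KnifeEdge.rplus_gramBordered_decided`),
`R⁺ ++ [(L-b)∣μψ]` (`rplus_muPsiOverhangAll_decided`), `R⁺ ++ [(L-b)∣νψ]` (`rplus_nuOverhangAll_decided`),
`R⁺ ++ [band edge]` (`rplus_bandEdge_decided`), `R⁺ ++ [smooth band edge, top]` (`rplus_smoothBandEdge_decided`) are sub-lists.
[cite: Zhang2022LandauSiegel, §2 (2.32)–(2.33)] -/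
theorem rplusplus8_decided_sublists :
    ClassDecided (Rplus ++ [KnifeEdge.familyGramBlockDict]) ∧ ClassDecided (Rplus ++ [KnifeEdge.familyGramBordered]) ∧
      ClassDecided (Rplus ++ [familyMuPsiOverhangAll]) ∧ ClassDecided (Rplus ++ [familyNuOverhangAll]) ∧
      ClassDecided (Rplus ++ [familyBandEdge]) ∧ ClassDecided (Rplus ++ [familySmoothBandEdge, familySmoothTopBandEdge]) := by
  refine ⟨rplusplus8_decided.mono fun F hF => ?_, rplusplus8_decided.mono fun F hF => ?_,
    rplusplus8_decided.mono fun F hF => ?_, rplusplus8_decided.mono fun F hF => ?_,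
    rplusplus8_decided.mono fun F hF => ?_, rplusplus8_decided.mono fun F hF => ?_⟩ <;>
  · simp only [Rplus, List.cons_append, List.nil_append, List.mem_cons, List.not_mem_nil, or_false,
      mem_rplusplus8_iff] at hF ⊢
    tauto

/-- **The KILL(B-multi) intake list v6 is inside version 8**: every family of p3's `bmultiWord6` (RepairIntakeBmulti Part 11,
p469194: `bmultiWord5 ++ [familyGramBlockAll, familyGramBlockDict]`) is a family of `Rplusplus8`.
[cite: Zhang2022LandauSiegel, §2 (2.32)–(2.33); §7 (7.2) p.44] -/
theorem bmultiWord6_sub_rplusplus8 : ∀ F ∈ bmultiWord6, F ∈ Rplusplus8 := by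
  intro F hF
  rcases List.mem_append.1 hF with h | h
  · exact rplusplus7_sub_rplusplus8 F (bmultiWord5_sub_rplusplus7 F h)
  · simp only [List.mem_cons, List.not_mem_nil, or_false] at h
    rw [mem_rplusplus8_iff]
    tauto

/-- … hence `bmultiWord6_decided` is an instance of `rplusplus8_decided`. [cite: Zhang2022LandauSiegel, §2 (2.32)–(2.33)] -/
theorem rplusplus8_decided_bmultiWord6 : ClassDecided bmultiWord6 := rplusplus8_decided.mono bmultiWord6_sub_rplusplus8

/-- **The KILL(B-len) intake list v2 is inside version 8**: every family of `blenWord2` (RepairIntakeBlen Part 5: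
`blenWord ++ [familyLambdaOverhangAll, familyLambdaGradedAll, familyMuPsiOverhangAll, familyNuOverhangAll, familyWallZeroMain,
familyWallZeroTopMain]`) is a family of `Rplusplus8`. [cite: Zhang2022LandauSiegel, §2 (2.32)–(2.33); §7 Prop 7.1 (7.2) p.44] -/
theorem blenWord2_sub_rplusplus8 : ∀ F ∈ blenWord2, F ∈ Rplusplus8 := by
  intro F hF
  rcases List.mem_append.1 hF with h | h
  · exact rplusplus7_sub_rplusplus8 F (blenWord_sub_rplusplus7 F h)
  · simp only [List.mem_cons, List.not_mem_nil, or_false] at h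
    rw [mem_rplusplus8_iff]
    tauto

/-- … hence `blenWord2_decided` is an instance of `rplusplus8_decided`. [cite: Zhang2022LandauSiegel, §2 (2.32)–(2.33)] -/
theorem rplusplus8_decided_blenWord2 : ClassDecided blenWord2 := rplusplus8_decided.mono blenWord2_sub_rplusplus8

/-- **Both words at once (v6 + v2)**: the union of the two intake lists of record is decided, as a sub-list of version 8.
[cite: Zhang2022LandauSiegel, §2 (2.32)–(2.33); §7 Prop 7.1 (7.2) p.44] -/
theorem rplusplus8_decided_words : ClassDecided (bmultiWord6 ++ blenWord2) := by
  refine rplusplus8_decided.mono fun F hF => ?_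
  rcases List.mem_append.1 hF with h | h
  · exact bmultiWord6_sub_rplusplus8 F h
  · exact blenWord2_sub_rplusplus8 F h

/-- … and so are the two words as ONE family each (the sum families dispatch constructor-wise to rows of version 8):
`R⁺ ++ [familyBmulti6, familyBlen2]` is decided — cited by term from the intake files, recorded next to the class of record.
[cite: Zhang2022LandauSiegel, §2 (2.32)–(2.33)] -/
theorem rplus_words_asFamilies_decided : ClassDecided (Rplus ++ [familyBmulti6, familyBlen2]) :=
  classDecided_append.2 ⟨rplus_decided, classDecided_cons familyBmulti6_decided <|
    classDecided_cons familyBlen2_decided classDecided_nil⟩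

/-- **Unbundled reading of rows 27–33** (what version 8 adds, every class binder literal): the mixed dictionary
verdict, the completed-member verdict with its two slots, the μψ robust verdict with its sign slot, the νψ
invisibility verdict with its slot and (b)-binders, and the three slot-free band-edge verdicts. [cite: Zhang2022LandauSiegel, §2 (2.16)–(2.20), (2.32)–(2.33); §7 Prop 7.1 (7.2) p.44] -/
theorem rplusplus8_verdicts :
    (∀ (k : ℕ) (p : Fin k → KnifeEdge.MixedPiece) (G : Matrix (Fin k) (Fin k) ℂ), (∀ i, (p i).Admissible) →
        G.IsHermitian → ∀ (Λs : KnifeEdge.BandScale) (c' : ℝ),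
          KnifeEdge.GramDictionary c' (fun i => (p i).table Λs) G → Skeleton.Prop22i → Skeleton.Lemma23 c' →
            (∃ D₀ : ℕ, ∀ (D : ℕ) [NeZero D] (χ : DirichletCharacter ℂ D),
                D₀ ≤ D → χ.IsQuadratic → χ.IsPrimitive → ¬ Skeleton.AssumptionA D χ) ∨
              ∀ x : Fin k → ℂ, ¬ (KnifeEdge.gramForm G x < 0)) ∧
    (∀ d : KnifeEdge.BorderedDesign, KinkedProfile d.u d.u' → (∀ i, (d.piece i).Admissible) →
        d.block.PosSemidef →
          (((mainTermForm d.u d.u' : ℝ) : ℂ) • d.block - Matrix.vecMulVec d.coupling (star d.coupling)).PosSemidef →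
            ∀ x : Fin (d.k + 1) → ℂ, ¬ (KnifeEdge.gramForm d.gram x < 0)) ∧
    (∀ (b : ℝ) (g g' : ℝ → ℂ), 1 < b → OneSidedProfile b g g' → ∀ (C : ℝ) (M : (ℝ → ℂ) → (ℝ → ℂ) → ℝ), 0 ≤ C →
        MuPsiDiagNonneg b M → ¬ (M g g' + C * KnifeEdge.oneSidedNormSq b g g' < 0)) ∧
    (∀ (θ : ℝ) (v v' : ℝ → ℂ), 1 < θ → KnifeEdge.bvOverhang θ v v' → ∀ (c' : ℝ) (S : KnifeEdge.Scale),
        KnifeEdge.NuMeanInvisible c' θ (KnifeEdge.bvOverhang θ) S → KnifeEdge.ScaleEventuallyPos S → Skeleton.Prop22i →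
          Skeleton.Lemma23 c' →
            KnifeEdge.NuDict c' θ (KnifeEdge.bvOverhang θ) S (fun _ _ => 0) 0 ∧
              ∀ m : ℝ, 0 ≤ m → ∀ F : (D : ℕ) → [NeZero D] → DirichletCharacter ℂ D → Skeleton.Chr D → ℂ → ℂ,
                HasMainConstant c' S F m → HasMainConstant c' S ((⟨θ, v, v'⟩ : NuDesign).extend F) m) ∧
    (∀ (c' : ℝ) (g : ℝ → ℂ), LipschitzWith 1 g → (∀ z, ‖g z‖ ≤ 1) → (BandEdgeDesign.mk c' g).Verdict) ∧
    (∀ d : SmoothDesign, d.InClass → d.VerdictBandEdge) ∧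
    (∀ d : SmoothTopDesign, d.InClass → d.VerdictBandEdge) :=
  ⟨fun k p G hp hH Λs c' hT h22 h23 => KnifeEdge.familyGramBlockDict_decided ⟨k, p, G⟩ hp hH Λs c' hT h22 h23,
    fun d hu hp hR hS x => KnifeEdge.familyGramBordered_decided d ⟨hu, hp⟩ hR hS x,
    fun b g g' hb hg C M hC hM => familyMuPsiOverhangAll_decided ⟨b, g, g'⟩ ⟨hb, hg⟩ C M hC hM,
    fun θ v v' hθ hv c' S hInv hS h22 h23 => familyNuOverhangAll_decided ⟨θ, v, v'⟩ ⟨hθ, hv⟩ c' S hInv hS h22 h23,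
    fun c' g hg hb => familyBandEdge_decided ⟨c', g⟩ ⟨hg, hb⟩,
    fun d h => familySmoothBandEdge_decided d h,
    fun d h => familySmoothTopBandEdge_decided d h⟩

/-- **Rows 24 / 27 / 28 are three readings of ONE object** (bookkeeping): same designs for 24 and 27 (`GramDesign`,
same class), and a completed member IS a mixed member with the bulk as piece `0` and the bordered matrix
(`BorderedDesign.toGramDesign`, class preserved). [cite: Zhang2022LandauSiegel, §7 Prop 7.1 (7.2) p.44] -/
theorem gramRows_sameObject :
    KnifeEdge.familyGramBlockDict.Design = KnifeEdge.familyGramBlockAll.Design ∧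
      (∀ d : KnifeEdge.GramDesign, KnifeEdge.familyGramBlockDict.InClass d ↔ KnifeEdge.familyGramBlockAll.InClass d) ∧
      (∀ d : KnifeEdge.BorderedDesign, d.InClass → KnifeEdge.familyGramBlockAll.InClass d.toGramDesign) :=
  ⟨rfl, fun _ => Iff.rfl, fun _ hd => KnifeEdge.BorderedDesign.toGramDesign_inClass hd⟩

end Repair

end Literature.NumberTheory.LFunctions.Zhang2022
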